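import Summits.KontsevichZagierPeriods.KontsevichZagierPeriods.Theorems.TerasomaMultiplicationGammaHodgeSectorDefs
import Summits.KontsevichZagierPeriods.KontsevichZagierPeriods.Theorems.GammaHodgeSector.Negative.HodgeTest

/-!
# `GammaHodgeSector` (stmt-KontsevichZagierPeriods-3742), line `koblitz-ogus-halving`:
stub `stub_hodgeArithmetic` — the Hodge-test arithmetic interface

(a) The crux's Hodge condition implies the Koblitz–Ogus hypothesis `IsKOHodge D f` (the exact
hypothesis of `KoblitzOgus.hodge_eq_combination_int`) for the class function
`f = clD D (wordSym x y − wordSym x' y')`: for a unit `u ≡ u₀ (mod D)` and a level-`D` rational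
`a`, `β(u[a]) = {u₀ a} − ½[a ∉ ℤ]` (`koBern_mul_toZMod`), so `Σ_z f(z) β(uz)` is the Hodge test sum
at `u₀` minus half the weight difference; (b) the Hodge weights differ by `2k`
(`hodge_weight_balance`); (c) `weight` kills the six families of standard relators (only Gauss
multiplication needs a count: exactly one of `n` consecutive integers is divisible by `n`).
Reference: P. Deligne, *Hodge cycles on abelian varieties*, LNM 900 (1982), §7
[Deligne1982HodgeCycles].
-/

noncomputable section

open scoped BigOperators

namespace Summit.KontsevichZagierPeriods.GammaHodgeSectorKO

open Literature.NumberTheory.Transcendental Literature.NumberTheory.Transcendental.BetaSymbol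
open Summit.KontsevichZagierPeriods.GammaHodgeSectorNegative
  (Admissible CoprimeDen hodgeSum HodgeCondition intSums hodge_weight_balance)

/-- `fracInd q = 0` for rationals of denominator `1`. [folklore] -/
private theorem fracInd_of_den_eq_one {q : ℚ} (h : q.den = 1) : fracInd q = 0 := by
  simp [fracInd, h]

/-- `fracInd q = 1` for rationals of denominator `≠ 1`. [folklore] -/
private theorem fracInd_of_den_ne_one {q : ℚ} (h : q.den ≠ 1) : fracInd q = 1 := by
  simp [fracInd, h]

/-- `fracInd` of an integer is `0`. [folklore] -/
private theorem fracInd_intCast (z : ℤ) : fracInd (z : ℚ) = 0 :=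
  fracInd_of_den_eq_one (Rat.den_intCast z)

/-- A rational of denominator `1` is an integer. [folklore] -/
private theorem exists_int_of_den_eq_one {q : ℚ} (h : q.den = 1) : ∃ z : ℤ, q = z :=
  ⟨q.num, (Rat.coe_int_num_of_den_eq_one h).symm⟩

/-- `Int.fract q = 0` iff `q` has denominator `1`. [folklore] -/
private theorem fract_eq_zero_iff_den (q : ℚ) : Int.fract q = 0 ↔ q.den = 1 :=
  Int.fract_eq_zero_iff.trans
    ⟨fun ⟨z, hz⟩ => hz ▸ Rat.den_intCast z, fun h => ⟨q.num, Rat.coe_int_num_of_den_eq_one h⟩⟩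

/-- `fracInd q` is the indicator of `Int.fract q ≠ 0`. [folklore] -/
private theorem fracInd_eq_ite_fract (q : ℚ) : fracInd q = if Int.fract q = 0 then 0 else 1 := by
  by_cases h : q.den = 1 <;> simp [fracInd, h, fract_eq_zero_iff_den]

/-- `fracInd (a + 1) = fracInd a`. [folklore] -/
private theorem fracInd_add_one (a : ℚ) : fracInd (a + 1) = fracInd a := by
  have : a + 1 = a + ((1 : ℤ) : ℚ) := by rw [Int.cast_one]
  rw [fracInd, fracInd, this, Rat.add_intCast_den]

/-- `fracInd (1 - a) = fracInd a`. [folklore] -/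
private theorem fracInd_one_sub (a : ℚ) : fracInd (1 - a) = fracInd a := by
  have : 1 - a = ((1 : ℤ) : ℚ) - a := by rw [Int.cast_one]
  rw [fracInd, fracInd, this, Rat.intCast_sub_den]

/-- `fracInd (z / n) = [n ∤ z]`. [folklore] -/
private theorem fracInd_intCast_div {n : ℕ} (hn : n ≠ 0) (z : ℤ) :
    fracInd ((z : ℚ) / (n : ℚ)) = if (n : ℤ) ∣ z then 0 else 1 := by
  have h := Rat.den_div_intCast_eq_one_iff z (n : ℤ) (by exact_mod_cast hn)
  rw [Int.cast_natCast] at h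
  unfold fracInd
  by_cases hd : (n : ℤ) ∣ z
  · rw [if_pos (h.mpr hd), if_pos hd]
  · rw [if_neg (mt h.mp hd), if_neg hd]

/-- `weight (Σ_j [x_j, y_j]) = N + #{j | x_j + y_j ∈ ℤ}` for admissible data. [folklore] -/
private theorem weight_wordSym_eq {N : ℕ} {x y : Fin N → ℚ} (hx : Admissible x y) :
    weight (wordSym x y) = N + intSums x y := by
  unfold wordSym intSums
  rw [map_sum]
  have hterm : ∀ j, weight (bsym (x j) (y j)) =
      1 + (if Int.fract (x j + y j) = 0 then 1 else 0) := by
    intro j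
    obtain ⟨-, -, hxj, hyj⟩ := hx j
    rw [weight_bsym, fracInd_eq_ite_fract, fracInd_eq_ite_fract, fracInd_eq_ite_fract, if_neg hxj,
      if_neg hyj]
    split_ifs <;> ring
  rw [Finset.sum_congr rfl fun j _ => hterm j, Finset.sum_add_distrib, Finset.sum_boole]
  simp

/-- Exactly one of `m, m + 1, …, m + n` is divisible by `n + 1`. [folklore] -/
private theorem sum_range_ite_dvd (n : ℕ) (m : ℤ) :
    ∑ k ∈ Finset.range (n + 1), (if ((n + 1 : ℕ) : ℤ) ∣ (k : ℤ) + m then (1 : ℤ) else 0) = 1 := by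
  obtain ⟨r, hr⟩ : ∃ r : ℤ, r = (-m) % ((n + 1 : ℕ) : ℤ) := ⟨_, rfl⟩
  have hn' : (0 : ℤ) < ((n + 1 : ℕ) : ℤ) := by exact_mod_cast Nat.succ_pos n
  have hr0 : 0 ≤ r := hr ▸ Int.emod_nonneg _ hn'.ne'
  have hrn : r < ((n + 1 : ℕ) : ℤ) := hr ▸ Int.emod_lt_of_pos _ hn'
  have key : ∀ k ∈ Finset.range (n + 1), (((n + 1 : ℕ) : ℤ) ∣ (k : ℤ) + m ↔ k = r.toNat) := by
    intro k hk
    rw [Finset.mem_range] at hk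
    rw [Int.dvd_iff_emod_eq_zero, ← sub_neg_eq_add, ← Int.emod_eq_emod_iff_emod_sub_eq_zero,
      Int.emod_eq_of_lt (by positivity) (by exact_mod_cast hk), ← hr]
    omega
  rw [Finset.sum_congr rfl fun k hk => if_congr (key k hk) rfl rfl, Finset.sum_ite_eq',
    if_pos (Finset.mem_range.mpr (by omega))]

/-- The count behind the Gauss multiplication relator:
`Σ_{k=1}^{n} [k/(n+1) + s ∉ ℤ] = n + [(n+1)s ∉ ℤ] − [s ∉ ℤ]`. [folklore] -/
private theorem sum_fracInd_div_add (n : ℕ) (s : ℚ) :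
    ∑ k ∈ Finset.range n, fracInd (((k + 1 : ℕ) : ℚ) / ((n + 1 : ℕ) : ℚ) + s) =
      (n : ℤ) + fracInd (((n + 1 : ℕ) : ℚ) * s) - fracInd s := by
  have hn0 : ((n + 1 : ℕ) : ℚ) ≠ 0 := by exact_mod_cast Nat.succ_ne_zero n
  by_cases hns : (((n + 1 : ℕ) : ℚ) * s).den = 1
  · -- `(n+1) s = m ∈ ℤ`
    obtain ⟨m, hm⟩ := exists_int_of_den_eq_one hns
    have hs : s = (m : ℚ) / ((n + 1 : ℕ) : ℚ) := by
      rw [← hm, mul_div_cancel_left₀ s hn0]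
    have hterm : ∀ k : ℕ, fracInd (((k + 1 : ℕ) : ℚ) / ((n + 1 : ℕ) : ℚ) + s) =
        1 - (if ((n + 1 : ℕ) : ℤ) ∣ ((k + 1 : ℕ) : ℤ) + m then 1 else 0) := by
      intro k
      have : ((k + 1 : ℕ) : ℚ) / ((n + 1 : ℕ) : ℚ) + s =
          (((((k + 1 : ℕ) : ℤ) + m : ℤ)) : ℚ) / ((n + 1 : ℕ) : ℚ) := by
        rw [hs]; push_cast; ring
      rw [this, fracInd_intCast_div (Nat.succ_ne_zero n)]
      split_ifs <;> simp
    have hs' : fracInd s = 1 - (if ((n + 1 : ℕ) : ℤ) ∣ ((0 : ℕ) : ℤ) + m then 1 else 0) := by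
      rw [hs, fracInd_intCast_div (Nat.succ_ne_zero n), Nat.cast_zero, zero_add]
      split_ifs <;> simp
    have hcount := sum_range_ite_dvd n m
    rw [Finset.sum_range_succ'] at hcount
    rw [hm, fracInd_intCast, hs', Finset.sum_congr rfl fun k _ => hterm k, Finset.sum_sub_distrib]
    simp only [Finset.sum_const, Finset.card_range, nsmul_eq_mul, mul_one, Nat.cast_zero,
      zero_add] at hcount ⊢
    linarith
  · -- `(n+1) s ∉ ℤ`
    have hs1 : s.den ≠ 1 := by
      intro h1
      obtain ⟨z, rfl⟩ := exists_int_of_den_eq_one h1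
      apply hns
      rw [show ((n + 1 : ℕ) : ℚ) * (z : ℚ) = (((n + 1 : ℕ) * z : ℤ) : ℚ) by push_cast; ring]
      exact Rat.den_intCast _
    have hterm : ∀ k : ℕ, fracInd (((k + 1 : ℕ) : ℚ) / ((n + 1 : ℕ) : ℚ) + s) = 1 := by
      intro k
      apply fracInd_of_den_ne_one
      intro h1
      obtain ⟨z, hz⟩ := exists_int_of_den_eq_one h1
      apply hns
      have h2 : ((n + 1 : ℕ) : ℚ) * s = (((n + 1 : ℕ) * z - (k + 1 : ℕ) : ℤ) : ℚ) := by
        have h3 := congrArg (fun q => ((n + 1 : ℕ) : ℚ) * q) hz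
        simp only [mul_add, mul_div_cancel₀ _ hn0] at h3
        push_cast at h3 ⊢
        linear_combination h3
      rw [h2]
      exact Rat.den_intCast _
    rw [Finset.sum_congr rfl fun k _ => hterm k, fracInd_of_den_ne_one hns,
      fracInd_of_den_ne_one hs1]
    simp

/-- The Hodge weights of the two sides of the Gauss multiplication relator agree.
[cite: Deligne1982HodgeCycles, §7] -/
private theorem weight_multL_eq_multR {n : ℕ} (hn : 2 ≤ n) (s : ℚ) :
    weight (msym (multL n s)) = weight (msym (multR n s)) := by
  obtain ⟨n, rfl⟩ : ∃ n', n = n' + 1 := ⟨n - 1, by omega⟩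
  have hL : msym (multL (n + 1) s) =
      ∑ k ∈ Finset.range n, bsym (((k + 1 : ℕ) : ℚ) / ((n + 1 : ℕ) : ℚ)) s := by
    simp only [msym, multL, Multiset.map_map, Function.comp_def, Nat.add_sub_cancel]
    rfl
  have hR : msym (multR (n + 1) s) =
      ∑ j ∈ Finset.range n, bsym s (((j + 1 : ℕ) : ℚ) * s) := by
    simp only [msym, multR, Multiset.map_map, Function.comp_def, Nat.add_sub_cancel]
    rfl
  rw [hL, hR, map_sum, map_sum]
  simp only [weight_bsym]
  have hkn : ∀ k ∈ Finset.range n, fracInd (((k + 1 : ℕ) : ℚ) / ((n + 1 : ℕ) : ℚ)) = 1 := by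
    intro k hk
    rw [Finset.mem_range] at hk
    apply fracInd_of_den_ne_one
    rw [Ne, Rat.den_div_natCast_eq_one_iff _ _ (Nat.succ_ne_zero n)]
    exact Nat.not_dvd_of_pos_of_lt (Nat.succ_pos k) (by omega)
  have hLHS : ∑ k ∈ Finset.range n, (fracInd (((k + 1 : ℕ) : ℚ) / ((n + 1 : ℕ) : ℚ)) + fracInd s -
      fracInd (((k + 1 : ℕ) : ℚ) / ((n + 1 : ℕ) : ℚ) + s)) =
      (n : ℤ) * (1 + fracInd s) - ((n : ℤ) + fracInd (((n + 1 : ℕ) : ℚ) * s) - fracInd s) := by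
    rw [← sum_fracInd_div_add n s, Finset.sum_sub_distrib]
    congr 1
    rw [Finset.sum_congr rfl fun k hk =>
      show fracInd (((k + 1 : ℕ) : ℚ) / ((n + 1 : ℕ) : ℚ)) + fracInd s = 1 + fracInd s by
        rw [hkn k hk]]
    simp
  have hRHS : ∑ j ∈ Finset.range n, (fracInd s + fracInd (((j + 1 : ℕ) : ℚ) * s) -
      fracInd (s + ((j + 1 : ℕ) : ℚ) * s)) =
      (n : ℤ) * fracInd s + (fracInd s - fracInd (((n + 1 : ℕ) : ℚ) * s)) := by
    have h1 : ∀ j : ℕ, fracInd s + fracInd (((j + 1 : ℕ) : ℚ) * s) -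
        fracInd (s + ((j + 1 : ℕ) : ℚ) * s) =
        fracInd s + (fracInd (((j + 1 : ℕ) : ℚ) * s) - fracInd (((j + 1 + 1 : ℕ) : ℚ) * s)) := by
      intro j
      rw [show s + ((j + 1 : ℕ) : ℚ) * s = ((j + 1 + 1 : ℕ) : ℚ) * s by push_cast; ring]
      ring
    rw [Finset.sum_congr rfl fun j _ => h1 j, Finset.sum_add_distrib,
      Finset.sum_range_sub' (fun j => fracInd (((j + 1 : ℕ) : ℚ) * s)) n]
    simp
  rw [hLHS, hRHS]
  ring

/-- The Hodge weight agrees on the two sides of every standard relator pair.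
[cite: Deligne1982HodgeCycles, §7] -/
private theorem weight_relator {L R : Multiset (ℚ × ℚ)} (h : (L, R) ∈ relatorPairs) :
    weight (msym L) = weight (msym R) := by
  rcases h with (((((h | h) | h) | h) | h) | h)
  · obtain ⟨a, b, -, -, hp⟩ := h
    simp only [Prod.mk.injEq] at hp
    obtain ⟨rfl, rfl⟩ := hp
    simp only [msym_singleton, weight_bsym, add_comm b a]
    ring
  · obtain ⟨a, b, -, -, hp⟩ := h
    simp only [Prod.mk.injEq] at hp
    obtain ⟨rfl, rfl⟩ := hp
    simp only [msym_singleton, weight_bsym]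
    rw [show a + 1 + b = (a + b) + 1 by ring, fracInd_add_one, fracInd_add_one]
  · obtain ⟨a, b, c, -, -, -, hp⟩ := h
    simp only [Prod.mk.injEq] at hp
    obtain ⟨rfl, rfl⟩ := hp
    simp only [Multiset.insert_eq_cons, msym_cons, msym_singleton, map_add, weight_bsym]
    rw [← add_assoc a b c]
    ring
  · obtain ⟨n, s, hn, -, hp⟩ := h
    simp only [Prod.mk.injEq] at hp
    obtain ⟨rfl, rfl⟩ := hp
    exact weight_multL_eq_multR hn s
  · obtain ⟨a, ha0, ha1, hp⟩ := h
    simp only [Prod.mk.injEq] at hp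
    obtain ⟨rfl, rfl⟩ := hp
    simp only [msym_singleton]
    rw [weight_betaHalf, weight_bsym, fracInd_one_sub, show a + (1 - a) = ((1 : ℤ) : ℚ) by simp,
      fracInd_intCast]
    have hden : a.den ≠ 1 := fun h1 => by
      obtain ⟨z, rfl⟩ := exists_int_of_den_eq_one h1
      exact absurd (show z < 1 by exact_mod_cast ha1)
        (not_lt.mpr (show (0 : ℤ) < z by exact_mod_cast ha0))
    rw [fracInd_of_den_ne_one hden]
    norm_num
  · simp only [Set.mem_singleton_iff, Prod.mk.injEq] at h
    obtain ⟨rfl, rfl⟩ := h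
    simp only [msym_singleton, msym_zero, map_zero, weight_bsym]
    norm_num [fracInd]

/-- The Hodge weight kills the span of the standard relators. [cite: Deligne1982HodgeCycles, §7] -/
private theorem weight_relSpan : ∀ v ∈ RelSpan, weight v = 0 := by
  intro v hv
  have h : RelSpan ≤ weight.ker := by
    refine (AddSubgroup.closure_le _).mpr ?_
    rintro _ ⟨⟨L, R⟩, hLR, rfl⟩
    rw [SetLike.mem_coe, AddMonoidHom.mem_ker, map_sub, sub_eq_zero]
    exact weight_relator hLR
  exact (AddMonoidHom.mem_ker).mp (h hv)

/-- A level-`D` rational has denominator dividing `D`. [folklore] -/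
private theorem den_dvd_of_isLevel {D : ℕ} [NeZero D] {a : ℚ} (h : IsLevel D a) : a.den ∣ D := by
  have hD : (D : ℚ) ≠ 0 := by exact_mod_cast NeZero.ne D
  have hM : ((a * D).num : ℚ) = a * D := Rat.coe_int_num_of_den_eq_one h.2
  have ha : a = ((a * D).num : ℚ) / (D : ℚ) := by rw [hM, mul_div_cancel_right₀ a hD]
  have := Rat.den_dvd (a * D).num D
  rw [Rat.divInt_eq_div, Int.cast_natCast, ← ha] at this
  exact_mod_cast this

/-- Level `D` is closed under addition. [folklore] -/
private theorem isLevel_add {D : ℕ} {a b : ℚ} (ha : IsLevel D a) (hb : IsLevel D b) :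
    IsLevel D (a + b) := by
  refine ⟨add_pos ha.1 hb.1, ?_⟩
  rw [add_mul]
  have := Rat.add_den_dvd (a * D) (b * D)
  rw [ha.2, hb.2, mul_one] at this
  exact Nat.dvd_one.mp this

/-- The Bernoulli distribution at `u·[a]` for a level-`D` rational `a` and a unit `u ≡ u₀ (mod D)`:
`β(u[a]) = {u₀ a} − ½[a ∉ ℤ]`. [cite: Deligne1982HodgeCycles, Rem. 7.16 (a)] -/
private theorem koBern_mul_toZMod {D : ℕ} [NeZero D] {u : ZMod D} {u0 : ℕ} (hu : (u0 : ZMod D) = u)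
    (hcop : Nat.Coprime u0 D) {a : ℚ} (ha : IsLevel D a) :
    koBern D (u * toZMod D a) = Int.fract ((u0 : ℚ) * a) - (fracInd a : ℚ) / 2 := by
  have hD : (D : ℚ) ≠ 0 := by exact_mod_cast NeZero.ne D
  obtain ⟨M, hMdef⟩ : ∃ M : ℤ, M = (a * D).num := ⟨_, rfl⟩
  have hM : (M : ℚ) = a * D := hMdef ▸ Rat.coe_int_num_of_den_eq_one ha.2
  have haM : a = (M : ℚ) / D := by rw [hM, mul_div_cancel_right₀ a hD]
  have hz : u * toZMod D a = ((u0 * M : ℤ) : ZMod D) := by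
    rw [toZMod, ← hMdef, ← hu]; push_cast; ring
  have hfract : Int.fract ((u0 : ℚ) * a) = (((u0 * M) % D : ℤ) : ℚ) / D := by
    rw [haM, show (u0 : ℚ) * ((M : ℚ) / D) = ((u0 * M : ℤ) : ℚ) / (D : ℚ) by push_cast; ring,
      Int.fract_div_intCast_eq_div_intCast_mod]
  rw [hz, hfract, koBern]
  by_cases hdvd : (D : ℤ) ∣ u0 * M
  · -- integral case: `a ∈ ℤ`
    rw [if_pos ((ZMod.intCast_zmod_eq_zero_iff_dvd _ _).mpr hdvd)]
    have hDM : (D : ℤ) ∣ M :=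
      (Nat.isCoprime_iff_coprime.mpr hcop).symm.dvd_of_dvd_mul_left hdvd
    obtain ⟨c, hc⟩ := hDM
    have ha_int : a = (c : ℚ) := by
      rw [haM, hc]; push_cast; rw [mul_div_cancel_left₀ (c : ℚ) hD]
    rw [Int.emod_eq_zero_of_dvd hdvd, ha_int, fracInd_intCast]
    simp
  · rw [if_neg (mt (ZMod.intCast_zmod_eq_zero_iff_dvd _ _).mp hdvd)]
    have hval : ((((u0 * M : ℤ) : ZMod D)).val : ℚ) = (((u0 * M) % D : ℤ) : ℚ) := by
      rw [← ZMod.val_intCast (u0 * M), Int.cast_natCast]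
    have hden : a.den ≠ 1 := by
      intro h1
      apply hdvd
      obtain ⟨z, hz1⟩ := exists_int_of_den_eq_one h1
      have : M = z * D := by
        apply Int.cast_injective (α := ℚ)
        rw [hM, hz1]; push_cast; ring
      rw [this, ← mul_assoc]
      exact dvd_mul_left _ _
    rw [hval, fracInd_of_den_ne_one hden]
    push_cast
    ring

/-- **STUB `stub_hodgeArithmetic` (Hodge-test arithmetic).** For admissible Hodge-type data of
level `D`, the class function `clD D (wordSym x y − wordSym x' y')` is of Koblitz–Ogus Hodge type,
the Hodge weights differ by `2k` (the weight balance `N + I = N' + I' + 2k`), and the weight kills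
every standard relator (the standard relations are of Hodge type).
[cite: Deligne1982HodgeCycles, Thm. 7.18] -/
theorem stub_hodgeArithmetic {N N' k : ℕ} (x y : Fin N → ℚ) (x' y' : Fin N' → ℚ)
    (hx : Admissible x y) (hx' : Admissible x' y') (hH : HodgeCondition N N' k x y x' y')
    (D : ℕ) [NeZero D] (hlev : ∀ j, IsLevel D (x j) ∧ IsLevel D (y j))
    (hlev' : ∀ l, IsLevel D (x' l) ∧ IsLevel D (y' l)) :
    IsKOHodge D (clD D (wordSym x y - wordSym x' y')) ∧
      weight (wordSym x y) - weight (wordSym x' y') = 2 * k ∧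
      ∀ v ∈ RelSpan, weight v = 0 := by
  have hb : weight (wordSym x y) - weight (wordSym x' y') = 2 * k := by
    rw [weight_wordSym_eq hx, weight_wordSym_eq hx']
    have := hodge_weight_balance hx hx' hH
    omega
  refine ⟨?_, hb, weight_relSpan⟩
  intro u hu
  obtain ⟨u', rfl⟩ := hu
  have hDpos : 0 < D := Nat.pos_of_ne_zero (NeZero.ne D)
  -- a positive representative `u0` of the unit `u`, coprime to `D`
  obtain ⟨u0, hu0def⟩ : ∃ u0 : ℕ, u0 = (u' : ZMod D).val + D := ⟨_, rfl⟩
  have hu0 : (u0 : ZMod D) = (u' : ZMod D) := by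
    rw [hu0def, Nat.cast_add, ZMod.natCast_zmod_val, ZMod.natCast_self, add_zero]
  have hcop : Nat.Coprime u0 D :=
    hu0def ▸ Nat.coprime_add_self_left.mpr (ZMod.val_coe_unit_coprime u')
  have hu0pos : 0 < u0 := by omega
  have hcd : CoprimeDen x y u0 := fun j =>
    ⟨hcop.coprime_dvd_right (den_dvd_of_isLevel (hlev j).1),
     hcop.coprime_dvd_right (den_dvd_of_isLevel (hlev j).2)⟩
  have hcd' : CoprimeDen x' y' u0 := fun l =>
    ⟨hcop.coprime_dvd_right (den_dvd_of_isLevel (hlev' l).1),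
     hcop.coprime_dvd_right (den_dvd_of_isLevel (hlev' l).2)⟩
  -- the functional `f ↦ Σ_z f(z) β(u z)`
  let Φ : (ZMod D → ℤ) →+ ℚ :=
    { toFun := fun f => ∑ z : ZMod D, (f z : ℚ) * koBern D ((u' : ZMod D) * z)
      map_zero' := by simp
      map_add' := fun f g => by simp [Finset.sum_add_distrib, add_mul] }
  have hΦ : ∀ a : ℚ, Φ (eZ D a) = koBern D ((u' : ZMod D) * toZMod D a) := by
    intro a
    show ∑ z : ZMod D, ((eZ D a z : ℤ) : ℚ) * koBern D ((u' : ZMod D) * z) = _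
    simp [eZ, Finset.sum_ite_eq']
  have hΦb : ∀ a b : ℚ, IsLevel D a → IsLevel D b →
      Φ (clD D (bsym a b)) =
        (Int.fract ((u0 : ℚ) * a) + Int.fract ((u0 : ℚ) * b) - Int.fract ((u0 : ℚ) * (a + b))) -
          ((fracInd a : ℚ) + (fracInd b : ℚ) - (fracInd (a + b) : ℚ)) / 2 := by
    intro a b ha hb'
    rw [clD_bsym, map_sub, map_add, hΦ, hΦ, hΦ, koBern_mul_toZMod hu0 hcop ha,
      koBern_mul_toZMod hu0 hcop hb', koBern_mul_toZMod hu0 hcop (isLevel_add ha hb')]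
    ring
  have hsplit : ∀ {M : ℕ} (T U : Fin M → ℚ),
      ∑ j, (T j - U j / 2) = ∑ j, T j - (∑ j, U j) / 2 := fun T U => by
    rw [Finset.sum_sub_distrib, Finset.sum_div]
  show Φ (clD D (wordSym x y - wordSym x' y')) = 0
  rw [map_sub, map_sub, wordSym, wordSym, map_sum, map_sum, map_sum, map_sum,
    Finset.sum_congr rfl fun j _ => hΦb _ _ (hlev j).1 (hlev j).2,
    Finset.sum_congr rfl fun l _ => hΦb _ _ (hlev' l).1 (hlev' l).2,
    hsplit, hsplit]
  have hHu := hH u0 hu0pos hcd hcd'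
  unfold hodgeSum at hHu
  have hbq : (((weight (wordSym x y) - weight (wordSym x' y') : ℤ)) : ℚ) = ((2 * k : ℤ) : ℚ) := by
    rw [hb]
  rw [wordSym, wordSym, map_sum, map_sum] at hbq
  simp only [weight_bsym] at hbq
  push_cast at hbq
  linear_combination hHu - (1 / 2 : ℚ) * hbq

end Summit.KontsevichZagierPeriods.GammaHodgeSectorKO
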